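import Literature.MathematicalPhysics.QuantumLattice.XXZAntiferromagnetGroundStateOrder
import Literature.MathematicalPhysics.QuantumLattice.AndersonXYStarSharpBound
import HarnessLib

/-!
# Ising-axis (Néel) ground-state order of the spin-½ XXZ antiferromagnet on `ℤ²`: the certified sub-window widened to `Δ ≥ 7/3` (sharp star bound) and `Δ ≥ 9/4` (§5: plus the plaquette variational bound)

Topic `MathematicalPhysics/QuantumLattice`; a leaf above `XXZGroundStateIsingOrder.lean` (window
`Δ ≥ 5/2`) and `XXZAntiferromagnetGroundStateOrder.lean` (the same window in the standard
`xxzHamiltonian` vocabulary). Nothing there is edited; this file re-runs the assembly of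
`xxz_ground_neel_spinHalf_isingSide_of_gaussianDomination` with ONE input replaced: Anderson's XY
star bound `E₀(H_XY) ≥ -(2d+1)L^d/8` (`xyTorus_one_groundEnergy_ge`, constant `(k+1)²/16` for the
star) is replaced by its sharp form `E₀(H_XY) ≥ -(√(2d(2d+2))/8)·L^d`
(`xyTorus_one_groundEnergy_ge_sharp`, constant `k(k+2)/16`, `AndersonXYStarSharpBound.lean`).
In `d = 2` this lowers the bound on Björnberg–Ueltschi's `α(∞) = j(c² - c¹)` from `5j/16` to
`(√6/8)·j ≈ 0.3062·j`, and the positivity step of B–U's first bound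
(`¼ - a - ½·0.651·√a > 0`, which holds for `a ≤ 0.1318…`, not only for `a ≤ 1/8`) is re-done with the
constant `a ≤ 0.131224`; together: long-range order for `0 ≤ j ≤ 3/7`, i.e. **`Δ = 1/j ≥ 7/3`**
(was `Δ ≥ 5/2`).

Printed results (all `S = ½`, `d = 2`, ground state): Kubo–Kishi 1988 `Δ ≥ 1.78`;
Ozeki–Nishimori–Tomita 1989 `Δ ≥ 1.72`; Nishimori–Ozeki 1989 `Δ ≥ 1.67`; Wischmann–Müller-Hartmann
1991 `Δ ≥ 1.47` (Lanczos energy inputs) — statements as reported in the held secondary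
[WischmannMullerhartmann1991, Abstract p. 647, §1 p. 648]. The window proved here, `Δ ≥ 7/3`, is
still a certified SUB-window of the printed Ising-like region, WEAKER than print:
-- TODO(general form): `Δ ≥ 1.78` [KuboKishi1988] needs Kubo–Kishi's correlation inequalities and
-- cluster / variational energy inputs (W–MH 1991 §§2–4); with the inputs of the tree (B–U's first
-- bound, the polarised-state bound (3.10), `R_L(2) ≤ 0.651`, an L-uniform lower bound on the XY torus
-- energy) the window is `j ≤ a*/κ` with `¼ - a* - 0.3255√a* = 0` (`a* ≈ 0.1318`) and `κ` the certified
-- bound on `c² - c¹`; `κ = √6/8` (this file) gives `Δ ≥ 2.33`, the exact XY energy would give `≈ 2.1`.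

Contents:

* `xyz_bondCorr_two_sub_one_le_sharp` (spin ½, even torus of side `2k ≥ 4`, any `d ≥ 1`, any
  couplings): `c² - c¹ ≤ √(2d(2d+2))/(8d)` (`= √6/8` in `d = 2`);
* `isingSide_positivity_sharp`: `a ≤ 0.131224`, `0 ≤ R ≤ 0.651`, `¼ ≤ c⁰ + a`, `c⁰ ≤ m + ½√a·R`
  `⇒ m ≥ 1/1200`;
* `xxz_ground_neel_spinHalf_isingSide_of_gaussianDomination_sharp`, `xxz_ground_neel_spinHalf_isingSide_sharp`
  (`0 ≤ j ≤ 3/7`), `xxz_ground_neel_spinHalf_isingSide_sharp'` (`Δ ≥ 7/3`) in B–U's rotated frame;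
* `xxzAF_ground_neel_spinHalf_sharp`: for every `J > 0` and `Δ ≥ 7/3`, STAGGERED `z`-order of the
  ground states of `xxzHamiltonian 1 (torusGraph 2 L) J Δ` along even tori (the dictionary
  `hasStaggeredEvenTorusLRO_xxz_two_iff` of `XXZAntiferromagnetGroundStateOrder.lean`);
* §5 (a second tree input, the plaquette variational bound `xyz_plaquette_bound` of
  `XYZGroundStateOrderPlaquetteEnergy.lean` in place of the polarised state):
  `isingSide_positivity_plaquette`, `xxz_ground_neel_spinHalf_isingSide_of_gaussianDomination_plaquette`,
  `xxz_ground_neel_spinHalf_isingSide_plaquette` (`0 ≤ j ≤ 4/9`), `…_plaquette'` and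
  `xxzAF_ground_neel_spinHalf_plaquette` (**`Δ ≥ 9/4`**, the widest certified Ising-side window).

No definition and no named fact is introduced; sorry-free.

## References

* [KuboKishi1988] K. Kubo, T. Kishi, *Existence of long-range order in the XXZ model*, Phys. Rev.
  Lett. 61 (1988) 2585 — Ising-like region `Δ ≥ 1.78` (as reported in W–MH 1991 §1; primary not
  held, acq-01618 cite-only).
* [WischmannMullerhartmann1991] H.-A. Wischmann, E. Müller-Hartmann, J. Phys. I France 1 (1991)
  647–657, doi:10.1051/jp1:1991109 — Abstract (p. 647), §1 (p. 648): the printed windows.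
* [BjornbergUeltschi2022] J. E. Björnberg, D. Ueltschi, arXiv:2204.12896 — Thm. 3.2 (first bound),
  (3.10), Prop. 2.4, (4.38)–(4.41).
* [Anderson1951] P. W. Anderson, Phys. Rev. 83 (1951) 1260 — star lower bound (sharp constant
  `k(k+2)/16`, `AndersonXYStarSharpBound.lean`).
* [DysonLiebSimon1978] F. J. Dyson, E. H. Lieb, B. Simon, J. Stat. Phys. 18 (1978) 335, §2 —
  sublattice rotations.
-/

noncomputable section

open Matrix Finset Filter Topology
open scoped ComplexOrder
open Literature.MathematicalPhysics.QuantumLattice Literature.MathematicalPhysics.QuantumLattice.SpinOperators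
  Literature.Probability.LatticeModels

namespace Literature.MathematicalPhysics.QuantumLattice

variable {d : ℕ}

/-! ### 1. The transverse nearest-neighbour correlation is bounded by Anderson's SHARP XY constant -/

section Transverse

variable (J₁ J₂ : ℝ)

/-- **Anderson's sharp star bound transported to the rotated frame** (spin ½, even torus of side
`2k ≥ 4`, `d ≥ 1`, ANY couplings `J₁, J₂`): the ground-state bond correlations of `H' = H(1, J₂, J₁)`
satisfy `c² - c¹ ≤ √(2d(2d+2))/(8d)` (`√6/8 ≈ 0.3062` in `d = 2`; compare `(2d+1)/(8d) = 5/16` in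
`xyz_bondCorr_two_sub_one_le`). Same proof: `-2dL^d(c² - c¹) = Re ω(H(0,-1,1)) ≥ E₀(H(0,-1,1))`,
`H(0,-1,1) ≃ H(0,1,1) ≃ H(1,1,0) = 2·H_XY` (sublattice half-turn about the third axis, global frame
rotation), and `E₀(H_XY) ≥ -(√(2d(2d+2))/8)·L^d` (`xyTorus_one_groundEnergy_ge_sharp`, the star
constant `k(k+2)/16` with `k = 2d`). [cite: Anderson1951]
[cite: BjornbergUeltschi2022, Prop. 2.4 and (3.8)] -/
theorem xyz_bondCorr_two_sub_one_le_sharp (hd : 0 < d) (k : ℕ) (hk : 2 ≤ k) :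
    haveI : NeZero (2 * k) := ⟨by omega⟩
    xyzBondCorr (d := d) 2 (2 * k) 1 J₁ J₂ - xyzBondCorr (d := d) 1 (2 * k) 1 J₁ J₂ ≤
      Real.sqrt (2 * (d : ℝ) * (2 * (d : ℝ) + 2)) / (8 * d) := by
  haveI : NeZero (2 * k) := ⟨by omega⟩
  haveI : Nonempty (TensorIndex (TorusSite d (2 * k)) 2) := ⟨fun _ => 0⟩
  have hL3 : 3 ≤ 2 * k := by omega
  set L := 2 * k with hLdef
  have hLpos : (0 : ℝ) < (L : ℝ) ^ d := by positivity
  have hd' : (0 : ℝ) < d := by exact_mod_cast hd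
  -- (1) variational principle in the ground state of `H'`
  have h1 := groundEnergy_le_groundStateFunctional_re
    (anisotropicTorus_isHermitian L 1 1 J₂ J₁ (d := d)) (anisotropicTorus_isHermitian L 1 0 (-1) 1 (d := d))
  rw [re_groundStateFunctional_anisotropicTorus L 1 J₁ J₂ hL3 hd 0 (-1) 1] at h1
  -- (2) `E₀(H(0,-1,1)) = E₀(H(0,1,1))`: sublattice half-turn about the third axis
  obtain ⟨T, hT, hT', hTx, hTy, hTz⟩ := exists_halfTurn_z 1
  have h2 : (anisotropicTorus d L 1 0 (-1) 1).groundEnergy = (anisotropicTorus d L 1 0 1 1).groundEnergy := by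
    have hconj := sublatticeOpZ_conj_anisotropicTorus (d := d) k hT hT' hTx hTy hTz 0 (-1) 1
    rw [neg_zero, neg_neg] at hconj
    rw [← hconj, Matrix.groundEnergy_unitary_conj]
    refine Matrix.mem_unitaryGroup_iff.2 (productOp_mul_conjTranspose fun z => ?_)
    split_ifs
    · rw [conjTranspose_one, Matrix.mul_one]
    · exact hT
  -- (3) `E₀(H(0,1,1)) = E₀(H(1,1,0))`: global frame rotation `S⁰ ↔ S²`
  obtain ⟨V, hV, hV', hVz, hVx, hVy⟩ := exists_unitary_conj_spinZ_eq_spinX 1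
  have h3 : (anisotropicTorus d L 1 0 1 1).groundEnergy = (anisotropicTorus d L 1 1 1 0).groundEnergy := by
    have hconj : productOp (fun _ : TorusSite d L => V) * anisotropicTorus d L 1 0 1 1 *
        (productOp (fun _ : TorusSite d L => V))ᴴ = anisotropicTorus d L 1 1 1 0 := by
      rw [globalOp_conj_anisotropicTorus hV hV' (γ := ![2, 1, 0]) (ε := ![-1, 1, 1])
        (fun α => by fin_cases α <;> simp) (fun α => by
          fin_cases α
          · simpa using hVx
          · simpa using hVy
          · simpa using hVz) 0 1 1, anisotropicTorus_eq]
      rw [neg_inj]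
      refine sum_congr rfl fun x _ => sum_congr rfl fun y _ => ?_
      split_ifs
      · simp only [Matrix.cons_val_zero, Matrix.cons_val_one, Matrix.cons_val, Complex.ofReal_zero,
          Complex.ofReal_one, zero_smul, one_smul, zero_add, add_zero]
        abel
      · rfl
    have hWu : productOp (fun _ : TorusSite d L => V) ∈
        Matrix.unitaryGroup (TensorIndex (TorusSite d L) 2) ℂ :=
      Matrix.mem_unitaryGroup_iff.2 (productOp_mul_conjTranspose fun _ => hV)
    rw [← hconj, Matrix.groundEnergy_unitary_conj hWu]
  -- (4) `E₀(H(1,1,0)) = 2E₀(H_XY) ≥ -(√(2d(2d+2))/4)·L^d` (the SHARP star constant)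
  have h4 : (anisotropicTorus d L 1 1 1 0).groundEnergy = 2 * (xyTorus d L 1).groundEnergy := by
    rw [anisotropicTorus_one_one_zero, show (2 : ℂ) = ((2 : ℝ) : ℂ) by norm_num,
      groundEnergy_smul_of_pos (xxzHamiltonian_isHermitian 1 (torusGraph d L) (-1) 0) two_pos]
  have h5 := xyTorus_one_groundEnergy_ge_sharp L hL3 (d := d)
  have hs0 : 0 ≤ Real.sqrt (2 * (d : ℝ) * (2 * (d : ℝ) + 2)) := Real.sqrt_nonneg _
  -- assemble: `2dL^d (c² - c¹) ≤ (√(2d(2d+2))/4)·L^d`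
  rw [h2, h3, h4] at h1
  set p := xyzBondCorr (d := d) 2 L 1 J₁ J₂ - xyzBondCorr (d := d) 1 L 1 J₁ J₂ with hp
  set s := Real.sqrt (2 * (d : ℝ) * (2 * (d : ℝ) + 2)) with hsdef
  have h6 : 2 * (d : ℝ) * (L : ℝ) ^ d * p ≤ s / 4 * (L : ℝ) ^ d := by
    rw [hp]; nlinarith
  rw [le_div_iff₀ (by positivity)]
  have h7 : p * (8 * (d : ℝ)) * (L : ℝ) ^ d ≤ s * (L : ℝ) ^ d := by nlinarith
  exact le_of_mul_le_mul_right h7 hLpos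

end Transverse

/-! ### 2. Positivity of the first bound for `a ≤ 0.131224` -/

/-- **Positivity of B–U's first bound up to `a ≤ 0.131224`**: if `a ≤ 0.131224`, `0 ≤ R ≤ 0.651`,
`¼ ≤ c⁰ + a` (the polarised-state bound (3.10)) and `c⁰ ≤ m + ½√a·R` ((4.39)–(4.41)), then
`m ≥ 1/1200`: `√a ≤ 0.36225`, `m ≥ ¼ - 0.131224 - ½·0.36225·0.651 ≥ 0.00086`. (The root of
`¼ - a - 0.3255√a` is `a ≈ 0.13183`; `isingSide_positivity` used `a ≤ 1/8`.)
[cite: BjornbergUeltschi2022, Theorem 3.2 (first bound) and (3.10)] -/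
theorem isingSide_positivity_sharp {c0 a R m : ℝ} (ha : a ≤ 131224 / 1000000) (hR0 : 0 ≤ R)
    (hR : R ≤ 651 / 1000) (hV : 1 / 4 ≤ c0 + a) (hm : c0 ≤ m + 1 / 2 * Real.sqrt a * R) :
    1 / 1200 ≤ m := by
  have hs0 : 0 ≤ Real.sqrt a := Real.sqrt_nonneg a
  have hs : Real.sqrt a ≤ 36225 / 100000 := by
    rw [show (36225 / 100000 : ℝ) = Real.sqrt ((36225 / 100000) ^ 2) from
      (Real.sqrt_sq (by norm_num)).symm]
    exact Real.sqrt_le_sqrt (by nlinarith)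
  have hsR : Real.sqrt a * R ≤ 36225 / 100000 * (651 / 1000) := mul_le_mul hs hR hR0 (by norm_num)
  nlinarith

/-! ### 3. Assembly: the window `0 ≤ j ≤ 3/7`, i.e. `Δ ≥ 7/3` -/

/-- **The Ising-like window from Gaussian domination, sharp star constant** (finite-volume assembly,
`d = 2`, `S = ½`): if ground-state Gaussian domination holds for `H' = anisotropicTorus 2 L 1 1 (-j) j`
on all even tori of side `L ≥ 4` (all real fields) and the punctured Riemann sums satisfy
`R_L(2) ≤ 0.651` eventually, then for `0 ≤ j ≤ 3/7` the ground states of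
`anisotropicTorus 2 L 1 j (-j) 1` have long-range order of the third component: eventually
`(2k)⁻⁴ Σ_{x,y} ⟨S²_xS²_y⟩ ≥ 1/1200`. Steps as in
`xxz_ground_neel_spinHalf_isingSide_of_gaussianDomination`, with
`a = j(c² - c¹) ≤ (3/7)·(√24/16) ≤ 0.131224` from `xyz_bondCorr_two_sub_one_le_sharp`
(`√24 < 4.899`) and `isingSide_positivity_sharp`. [cite: BjornbergUeltschi2022, Thm. 3.2 (first bound)]
[cite: KuboKishi1988] -/
theorem xxz_ground_neel_spinHalf_isingSide_of_gaussianDomination_sharp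
    (hGD : ∀ (L : ℕ) [NeZero L], Even L → 4 ≤ L → ∀ (j : ℝ), 0 ≤ j →
      ∀ h : TorusSite 2 L → ℝ,
        (anisotropicTorus 2 L 1 1 (-j) j).groundEnergy ≤
          (anisotropicTorus 2 L 1 1 (-j) j - (2 : ℂ) • xyGradField L 1 h +
            ((xyFieldEnergy L h : ℝ) : ℂ) • 1).groundEnergy)
    (hR : ∀ᶠ L : ℕ in atTop, klsRiemannSum 2 L ≤ 651 / 1000) (j : ℝ) (hj : 0 ≤ j)
    (hj' : j ≤ 3 / 7) :
    HasEvenTorusLRO (fun L x y => groundStateAxisCorrTorus (d := 2) L 1 j (-j) 1 x y) := by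
  rw [hasEvenTorusLRO_iff]
  have h2k : Tendsto (fun k : ℕ => 2 * k) atTop atTop :=
    tendsto_atTop_atTop.2 fun b => ⟨b, fun k hk => by omega⟩
  have hRk : ∀ᶠ k : ℕ in atTop, klsRiemannSum 2 (2 * k) ≤ 651 / 1000 := h2k.eventually hR
  -- the numerical input `√24 < 4.899`, so `(3/7)·√24/16 ≤ 0.131224`
  have h24 : Real.sqrt 24 < 4899 / 1000 := by
    rw [Real.sqrt_lt' (by norm_num : (0 : ℝ) < 4899 / 1000)]
    norm_num
  have hev : ∀ᶠ k : ℕ in atTop, (1 / 1200 : ℝ) ≤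
      (∑ x ∈ halfOpenBox 2 (2 * k), ∑ y ∈ halfOpenBox 2 (2 * k),
          torusPullback (fun L x y => groundStateAxisCorrTorus (d := 2) L 1 j (-j) 1 x y) (2 * k) x y) /
        ((halfOpenBox 2 (2 * k)).card : ℝ) ^ 2 := by
    filter_upwards [hRk, eventually_ge_atTop 2] with k hk hk2
    haveI : NeZero (2 * k) := ⟨by omega⟩
    rw [xyz_lroSeq_eq 1 k (by omega) j (-j)]
    -- `a = J₂c¹ + J₁c² = j (c² - c¹) ∈ [0, 0.131224]`
    have hp := xyz_bondCorr_two_sub_one_le_sharp j (-j) (by norm_num : 0 < 2) k hk2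
    have h24' : Real.sqrt (2 * ((2 : ℕ) : ℝ) * (2 * ((2 : ℕ) : ℝ) + 2)) / (8 * ((2 : ℕ) : ℝ)) =
        Real.sqrt 24 / 16 := by norm_num
    rw [h24'] at hp
    have hp' : xyzBondCorr (d := 2) 2 (2 * k) 1 j (-j) - xyzBondCorr (d := 2) 1 (2 * k) 1 j (-j) ≤
        4899 / 16000 := by linarith
    have ha : -j * xyzBondCorr (d := 2) 1 (2 * k) 1 j (-j) + j * xyzBondCorr (d := 2) 2 (2 * k) 1 j (-j) ≤
        131224 / 1000000 := by
      nlinarith [mul_le_mul_of_nonneg_left hp' hj]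
    -- `|J₁c¹ + J₂c²| ≤ a`
    have hPF₁ := xyz_abs_bondCorr_one_le_two (2 * k) 1 j (-j) (by omega) (by linarith) (by linarith)
      (d := 2)
    have hab : |j * xyzBondCorr (d := 2) 1 (2 * k) 1 j (-j) + -j * xyzBondCorr (d := 2) 2 (2 * k) 1 j (-j)| ≤
        -j * xyzBondCorr (d := 2) 1 (2 * k) 1 j (-j) + j * xyzBondCorr (d := 2) 2 (2 * k) 1 j (-j) :=
      xyz_abs_b_le_a (by linarith) (by linarith) hPF₁
    -- (A) and `c⁰ ≤ m + ½ √a R`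
    have hA := fun q hq => xyz_infraredBound_of_groundEnergy_le (2 * k) 1 j (-j) (by omega) (by norm_num)
      (fun h => hGD (2 * k) (even_two_mul k) (by omega) j hj h) q hq
    have hineq := xyz_ineq 1 j (-j) (by norm_num : 1 ≤ 2) hk2 hab hA
    -- (V) `¼ ≤ c⁰ + a`
    have hV := xyz_polarised_bound (2 * k) 1 j (-j) (by omega) (by norm_num : 0 < 2) (d := 2)
    have hV' : 1 / 4 ≤ xyzBondCorr (d := 2) 0 (2 * k) 1 j (-j) +
        (-j * xyzBondCorr (d := 2) 1 (2 * k) 1 j (-j) + j * xyzBondCorr (d := 2) 2 (2 * k) 1 j (-j)) := by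
      norm_num at hV ⊢
      linarith
    exact isingSide_positivity_sharp ha (klsRiemannSum_nonneg _ _) hk hV' hineq
  exact lt_of_lt_of_le (by norm_num : (0 : ℝ) < 1 / 1200)
    (le_liminf_of_le (isCoboundedUnder_ge_of_le atTop fun k => xyz_lroSeq_le 1 k j (-j)) hev)

/-- **Ising-axis (Néel) ground-state long-range order of the spin-½ XXZ antiferromagnet on `ℤ²` for
`Δ ≥ 7/3` — a certified sub-window of the printed Ising-like region** (Kubo–Kishi 1988: `Δ ≥ 1.78`;
Ozeki–Nishimori–Tomita / Nishimori–Ozeki 1989: `1.72` / `1.67`; Wischmann–Müller-Hartmann 1991: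
`Δ ≥ 1.47`, as printed in W–MH Abstract p. 647 and §1 p. 648), widening the tree's
`xxz_ground_neel_spinHalf_isingSide` (`Δ ≥ 5/2`). In Björnberg–Ueltschi's vocabulary: for `d = 2`,
`S = ½` and `0 ≤ j ≤ 3/7`, the ground states (tracial ground-state functional, `β → ∞` before
`L → ∞`) of `-Σ_x Σ_{y∼x}(j S⁽¹⁾S⁽¹⁾ - j S⁽²⁾S⁽²⁾ + S⁽³⁾S⁽³⁾)` on the even tori `(ℤ/2kℤ)²` — `j = 1/Δ`
times the sublattice-rotated spin-½ XXZ antiferromagnet — have long-range order in the third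
direction: `liminf_k (2k)⁻⁴ Σ_{x,y} ⟨S⁽³⁾_xS⁽³⁾_y⟩_GS > 0` (indeed `≥ 1/1200` eventually). Inputs:
reflection positivity ⇒ ground-state Gaussian domination (`buSpinHalf_gaussianDomination`), certified
`R_L(2) ≤ 0.651` (`klsRiemannSum_two_eventually_le`), Anderson's SHARP XY star bound
(`xyz_bondCorr_two_sub_one_le_sharp`).
-- TODO(general form): the printed window `Δ ≥ 1.78` (Kubo–Kishi 1988; `1.47` W–MH 1991 with Lanczos
-- inputs) needs the Kubo–Kishi correlation inequalities and cluster / variational energies; not vendored.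
[cite: WischmannMullerhartmann1991, Abstract (p. 647) and §1 (p. 648)] [cite: KuboKishi1988]
[cite: BjornbergUeltschi2022, Theorem 3.2 (first bound)] -/
theorem xxz_ground_neel_spinHalf_isingSide_sharp :
    ∀ (j : ℝ), 0 ≤ j → j ≤ 3 / 7 →
      HasEvenTorusLRO (fun L x y => groundStateAxisCorrTorus (d := 2) L 1 j (-j) 1 x y) := by
  intro j hj hj'
  exact xxz_ground_neel_spinHalf_isingSide_of_gaussianDomination_sharp
    (fun L _ hL h4 j' hj'' h => buSpinHalf_gaussianDomination L 1 hL h4 hj'' (by linarith) h)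
    klsRiemannSum_two_eventually_le j hj hj'

/-- The same window in the anisotropy parameter: for every `Δ ≥ 7/3` the ground states of
`anisotropicTorus 2 L 1 (1/Δ) (-(1/Δ)) 1` (`= Δ⁻¹ ×` the sublattice-rotated XXZ antiferromagnet with
anisotropy `Δ`) have long-range order of the third component along even tori.
[cite: WischmannMullerhartmann1991, §1 (p. 648)] [cite: KuboKishi1988] -/
theorem xxz_ground_neel_spinHalf_isingSide_sharp' (Δ : ℝ) (hΔ : 7 / 3 ≤ Δ) :
    HasEvenTorusLRO (fun L x y => groundStateAxisCorrTorus (d := 2) L 1 (1 / Δ) (-(1 / Δ)) 1 x y) := by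
  have hΔ0 : 0 < Δ := by linarith
  refine xxz_ground_neel_spinHalf_isingSide_sharp (1 / Δ) (by positivity) ?_
  rw [div_le_div_iff₀ hΔ0 (by norm_num : (0 : ℝ) < 7)]
  linarith

/-! ### 4. The window in the standard `xxzHamiltonian` vocabulary -/

/-- **Néel order of the spin-½ XXZ antiferromagnet on `ℤ²` for `Δ ≥ 7/3`.** For every `J > 0` and
every `Δ ≥ 7/3`, the ground states (tracial ground-state functional, `β → ∞` before `L → ∞`) of
`xxzHamiltonian 1 (torusGraph 2 L) J Δ = J Σ_{⟨x,y⟩}(SˣSˣ + SʸSʸ + ΔSᶻSᶻ)` on the even tori `(ℤ/2kℤ)²`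
have STAGGERED long-range order of the `z`-component:
`liminf_k (2k)⁻⁴ Σ_{x,y} (-1)^x (-1)^y ⟨Sᶻ_x Sᶻ_y⟩_GS > 0` — widening `xxzAF_ground_neel_spinHalf`
(`Δ ≥ 5/2`); a certified sub-window of the printed Ising-like region (`Δ ≥ 1.78` Kubo–Kishi 1988,
`Δ ≥ 1.47` W–MH 1991); the dictionary `hasStaggeredEvenTorusLRO_xxz_two_iff` applied to
`xxz_ground_neel_spinHalf_isingSide_sharp'`.
[cite: WischmannMullerhartmann1991, Abstract (p. 647) and §1 (p. 648)] [cite: KuboKishi1988] -/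
theorem xxzAF_ground_neel_spinHalf_sharp (J : ℝ) (hJ : 0 < J) (Δ : ℝ) (hΔ : 7 / 3 ≤ Δ) :
    HasStaggeredEvenTorusLRO (fun L x y => groundStateXXZCorrTorus 2 (d := 2) L 1 J Δ x y) := by
  rw [hasStaggeredEvenTorusLRO_xxz_two_iff 1 hJ (by linarith)]
  exact xxz_ground_neel_spinHalf_isingSide_sharp' Δ hΔ

/-! ### 5. A second tree input: the plaquette variational bound instead of the polarised state — `Δ ≥ 9/4`

The polarised-state bound `c⁰ + a ≥ ¼` (B–U (3.10)) used above ignores the transverse quantum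
fluctuations of the Ising-like antiferromagnet. The tree already holds a variational bound with a
2×2 plaquette product state, PROVED for all couplings: `xyz_plaquette_bound`
(`XYZGroundStateOrderPlaquetteEnergy.lean`, written for the planar window):
`c⁰ + J₂c¹ + J₁c² ≥ ½(535J₁/10417 - 495J₂/10417 + 10001/41668 + (9991/20834)²)`. On the Ising
side `J₁ = j`, `J₂ = -j` this reads `c⁰ + a ≥ 0.234993… + 0.049438…·j`, which beats `¼` for
`j > 0.3035` (by `0.0062` at `j = 3/7`). With `a ≤ (4899/16000)·j` (the sharp star constant,
`√24 < 4.899`) and `R ≤ 0.651` the first bound stays positive up to `j ≈ 0.4465`; we certify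
`j ≤ 4/9`, i.e. **`Δ ≥ 9/4`** (margin `m ≥ 1/1300`). This is Wischmann–Müller-Hartmann's §4 step
("improved upper bounds on the ground state energies … starting from the Néel state") carried out
with the tree's certified plaquette state instead of their Lanczos energies. -/

/-- **Positivity of B–U's first bound with the plaquette variational input** on the window
`0 ≤ j ≤ 4/9`: if `a ≤ (4899/16000)·j` (sharp star bound), `0 ≤ R ≤ 0.651`,
`½(535j/10417 + 495j/10417 + 10001/41668 + (9991/20834)²) ≤ c⁰ + a` (`xyz_plaquette_bound` at
`J₁ = j`, `J₂ = -j`) and `c⁰ ≤ m + ½√a·R`, then `m ≥ 1/1300`. Worst case `j = 4/9`: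
`a ≤ 0.13609`, `√a ≤ 0.3689`, `m ≥ 0.234993 + 0.021973 - 0.136084 - 0.120077 ≥ 0.0008`.
[cite: BjornbergUeltschi2022, Theorem 3.2 (first bound)] [cite: WischmannMullerhartmann1991, §4 (p. 652)] -/
theorem isingSide_positivity_plaquette {c0 a R m j : ℝ} (hj' : j ≤ 4 / 9)
    (haj : a ≤ 4899 / 16000 * j) (hR0 : 0 ≤ R) (hR : R ≤ 651 / 1000)
    (hV : (1 / 2 : ℝ) * (j * (535 / 10417) + -j * (-(495 / 10417)) + 10001 / 41668 + (9991 / 20834) ^ 2) ≤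
      c0 + a)
    (hm : c0 ≤ m + 1 / 2 * Real.sqrt a * R) : 1 / 1300 ≤ m := by
  have ha : a ≤ 13608721 / 100000000 := by linarith
  have hs0 : 0 ≤ Real.sqrt a := Real.sqrt_nonneg a
  have hs : Real.sqrt a ≤ 3689 / 10000 := by
    rw [show (3689 / 10000 : ℝ) = Real.sqrt ((3689 / 10000) ^ 2) from
      (Real.sqrt_sq (by norm_num)).symm]
    exact Real.sqrt_le_sqrt (by nlinarith)
  have hsR : Real.sqrt a * R ≤ 3689 / 10000 * (651 / 1000) := mul_le_mul hs hR hR0 (by norm_num)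
  nlinarith

/-- **The Ising-like window from Gaussian domination with the plaquette input** (finite-volume
assembly, `d = 2`, `S = ½`): under ground-state Gaussian domination for
`anisotropicTorus 2 L 1 1 (-j) j` on the even tori of side `≥ 4` and `R_L(2) ≤ 0.651` eventually,
for `0 ≤ j ≤ 4/9` the ground states of `anisotropicTorus 2 L 1 j (-j) 1` have long-range order of the
third component (eventually `(2k)⁻⁴ Σ ⟨S²_xS²_y⟩ ≥ 1/1300`). As
`xxz_ground_neel_spinHalf_isingSide_of_gaussianDomination_sharp`, with `xyz_plaquette_bound j (-j)`
in place of `xyz_polarised_bound` and `isingSide_positivity_plaquette`.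
[cite: BjornbergUeltschi2022, Thm. 3.2 (first bound)] [cite: KuboKishi1988]
[cite: WischmannMullerhartmann1991, §4 (p. 652)] -/
theorem xxz_ground_neel_spinHalf_isingSide_of_gaussianDomination_plaquette
    (hGD : ∀ (L : ℕ) [NeZero L], Even L → 4 ≤ L → ∀ (j : ℝ), 0 ≤ j →
      ∀ h : TorusSite 2 L → ℝ,
        (anisotropicTorus 2 L 1 1 (-j) j).groundEnergy ≤
          (anisotropicTorus 2 L 1 1 (-j) j - (2 : ℂ) • xyGradField L 1 h +
            ((xyFieldEnergy L h : ℝ) : ℂ) • 1).groundEnergy)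
    (hR : ∀ᶠ L : ℕ in atTop, klsRiemannSum 2 L ≤ 651 / 1000) (j : ℝ) (hj : 0 ≤ j)
    (hj' : j ≤ 4 / 9) :
    HasEvenTorusLRO (fun L x y => groundStateAxisCorrTorus (d := 2) L 1 j (-j) 1 x y) := by
  rw [hasEvenTorusLRO_iff]
  have h2k : Tendsto (fun k : ℕ => 2 * k) atTop atTop :=
    tendsto_atTop_atTop.2 fun b => ⟨b, fun k hk => by omega⟩
  have hRk : ∀ᶠ k : ℕ in atTop, klsRiemannSum 2 (2 * k) ≤ 651 / 1000 := h2k.eventually hR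
  have h24 : Real.sqrt 24 < 4899 / 1000 := by
    rw [Real.sqrt_lt' (by norm_num : (0 : ℝ) < 4899 / 1000)]
    norm_num
  have hev : ∀ᶠ k : ℕ in atTop, (1 / 1300 : ℝ) ≤
      (∑ x ∈ halfOpenBox 2 (2 * k), ∑ y ∈ halfOpenBox 2 (2 * k),
          torusPullback (fun L x y => groundStateAxisCorrTorus (d := 2) L 1 j (-j) 1 x y) (2 * k) x y) /
        ((halfOpenBox 2 (2 * k)).card : ℝ) ^ 2 := by
    filter_upwards [hRk, eventually_ge_atTop 2] with k hk hk2
    haveI : NeZero (2 * k) := ⟨by omega⟩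
    haveI : NeZero k := ⟨by omega⟩
    rw [xyz_lroSeq_eq 1 k (by omega) j (-j)]
    -- `a = j (c² - c¹) ≤ (4899/16000) j`
    have hp := xyz_bondCorr_two_sub_one_le_sharp j (-j) (by norm_num : 0 < 2) k hk2
    have h24' : Real.sqrt (2 * ((2 : ℕ) : ℝ) * (2 * ((2 : ℕ) : ℝ) + 2)) / (8 * ((2 : ℕ) : ℝ)) =
        Real.sqrt 24 / 16 := by norm_num
    rw [h24'] at hp
    have hp' : xyzBondCorr (d := 2) 2 (2 * k) 1 j (-j) - xyzBondCorr (d := 2) 1 (2 * k) 1 j (-j) ≤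
        4899 / 16000 := by linarith
    have haj : -j * xyzBondCorr (d := 2) 1 (2 * k) 1 j (-j) + j * xyzBondCorr (d := 2) 2 (2 * k) 1 j (-j) ≤
        4899 / 16000 * j := by
      nlinarith [mul_le_mul_of_nonneg_left hp' hj]
    -- `|J₁c¹ + J₂c²| ≤ a`
    have hPF₁ := xyz_abs_bondCorr_one_le_two (2 * k) 1 j (-j) (by omega) (by linarith) (by linarith)
      (d := 2)
    have hab : |j * xyzBondCorr (d := 2) 1 (2 * k) 1 j (-j) + -j * xyzBondCorr (d := 2) 2 (2 * k) 1 j (-j)| ≤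
        -j * xyzBondCorr (d := 2) 1 (2 * k) 1 j (-j) + j * xyzBondCorr (d := 2) 2 (2 * k) 1 j (-j) :=
      xyz_abs_b_le_a (by linarith) (by linarith) hPF₁
    -- (A) and `c⁰ ≤ m + ½ √a R`
    have hA := fun q hq => xyz_infraredBound_of_groundEnergy_le (2 * k) 1 j (-j) (by omega) (by norm_num)
      (fun h => hGD (2 * k) (even_two_mul k) (by omega) j hj h) q hq
    have hineq := xyz_ineq 1 j (-j) (by norm_num : 1 ≤ 2) hk2 hab hA
    -- (V') the plaquette variational bound at `J₁ = j`, `J₂ = -j`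
    have hV := xyz_plaquette_bound (k := k) hk2 j (-j)
    have hV' : (1 / 2 : ℝ) * (j * (535 / 10417) + -j * (-(495 / 10417)) + 10001 / 41668 + (9991 / 20834) ^ 2) ≤
        xyzBondCorr (d := 2) 0 (2 * k) 1 j (-j) +
          (-j * xyzBondCorr (d := 2) 1 (2 * k) 1 j (-j) + j * xyzBondCorr (d := 2) 2 (2 * k) 1 j (-j)) := by
      linarith
    exact isingSide_positivity_plaquette hj' haj (klsRiemannSum_nonneg _ _) hk hV' hineq
  exact lt_of_lt_of_le (by norm_num : (0 : ℝ) < 1 / 1300)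
    (le_liminf_of_le (isCoboundedUnder_ge_of_le atTop fun k => xyz_lroSeq_le 1 k j (-j)) hev)

/-- **Ising-axis ground-state order of the spin-½ XXZ antiferromagnet on `ℤ²` for `0 ≤ j ≤ 4/9`
(`Δ = 1/j ≥ 9/4`)** in Björnberg–Ueltschi's frame: long-range order of the third component of the
ground states of `anisotropicTorus 2 L 1 j (-j) 1` along even tori. Inputs: ground-state Gaussian
domination (`buSpinHalf_gaussianDomination`), `klsRiemannSum_two_eventually_le`, the sharp star
bound and the plaquette variational bound. Still a SUB-window of print (`Δ ≥ 1.78`, Kubo–Kishi).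
-- TODO(general form): `Δ ≥ 1.78` needs the Kubo–Kishi correlation inequalities; not vendored.
[cite: WischmannMullerhartmann1991, Abstract (p. 647), §1 (p. 648), §4 (p. 652)] [cite: KuboKishi1988]
[cite: BjornbergUeltschi2022, Theorem 3.2 (first bound)] -/
theorem xxz_ground_neel_spinHalf_isingSide_plaquette :
    ∀ (j : ℝ), 0 ≤ j → j ≤ 4 / 9 →
      HasEvenTorusLRO (fun L x y => groundStateAxisCorrTorus (d := 2) L 1 j (-j) 1 x y) := by
  intro j hj hj'
  exact xxz_ground_neel_spinHalf_isingSide_of_gaussianDomination_plaquette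
    (fun L _ hL h4 j' hj'' h => buSpinHalf_gaussianDomination L 1 hL h4 hj'' (by linarith) h)
    klsRiemannSum_two_eventually_le j hj hj'

/-- The window `Δ ≥ 9/4` in the anisotropy parameter (B–U frame): for every `Δ ≥ 9/4` the ground
states of `anisotropicTorus 2 L 1 (1/Δ) (-(1/Δ)) 1` have long-range order of the third component along
even tori. [cite: WischmannMullerhartmann1991, §1 (p. 648)] [cite: KuboKishi1988] -/
theorem xxz_ground_neel_spinHalf_isingSide_plaquette' (Δ : ℝ) (hΔ : 9 / 4 ≤ Δ) :
    HasEvenTorusLRO (fun L x y => groundStateAxisCorrTorus (d := 2) L 1 (1 / Δ) (-(1 / Δ)) 1 x y) := by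
  have hΔ0 : 0 < Δ := by linarith
  refine xxz_ground_neel_spinHalf_isingSide_plaquette (1 / Δ) (by positivity) ?_
  rw [div_le_div_iff₀ hΔ0 (by norm_num : (0 : ℝ) < 9)]
  linarith

/-- **Néel order of the spin-½ XXZ antiferromagnet on `ℤ²` for `Δ ≥ 9/4`** (standard
`xxzHamiltonian` vocabulary): for every `J > 0` and every `Δ ≥ 9/4`, the ground states of
`xxzHamiltonian 1 (torusGraph 2 L) J Δ = J Σ_{⟨x,y⟩}(SˣSˣ + SʸSʸ + ΔSᶻSᶻ)` on the even tori `(ℤ/2kℤ)²`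
have STAGGERED long-range order of the `z`-component (`HasStaggeredEvenTorusLRO`) — the tree's
widest certified Ising-side window (`5/2` in `xxzAF_ground_neel_spinHalf`, `7/3` in
`xxzAF_ground_neel_spinHalf_sharp`); print: `Δ ≥ 1.78` (Kubo–Kishi 1988), `1.47` (W–MH 1991,
Lanczos inputs). [cite: WischmannMullerhartmann1991, Abstract (p. 647) and §1 (p. 648)]
[cite: KuboKishi1988] -/
theorem xxzAF_ground_neel_spinHalf_plaquette (J : ℝ) (hJ : 0 < J) (Δ : ℝ) (hΔ : 9 / 4 ≤ Δ) :
    HasStaggeredEvenTorusLRO (fun L x y => groundStateXXZCorrTorus 2 (d := 2) L 1 J Δ x y) := by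
  rw [hasStaggeredEvenTorusLRO_xxz_two_iff 1 hJ (by linarith)]
  exact xxz_ground_neel_spinHalf_isingSide_plaquette' Δ hΔ

end Literature.MathematicalPhysics.QuantumLattice
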